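import Literature.NumberTheory.Automorphic.GKModulesKSpanMatrixExp
import Literature.NumberTheory.Automorphic.GKModulesCurveLogChart
import HarnessLib

/-!
# The `K`-action of a `(𝔤, K)`-module is differentiable along differentiable curves in `K`, with differential `ρ𝔤|_𝔨` («KD»)

Topic `NumberTheory/Automorphic`; namespace `Literature.NumberTheory.Automorphic.IsGKModule`; sequel of ★ `GKModulesKSpanMatrixExp` and ★ `GKModulesCurveLogChart`.  Cell
`hodgecm-mathlib`, F0∕P3, ROAD-GLOB to the letter A6 #92 `HasUnitaryGlobalizationOfInfUnitary` at `U(2,1)`, brick **«KD» = K-DERIVATIVE ALONG CURVES**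
(LEAD F0P3b-p01 (g3) WANTED 2026-08-31T20:56:39Z; consumer: Φ2, the torus translation law, where `κ₁ = k₁⁻¹ k₁′`, `κ₂ = k₂′ k₂⁻¹` of the KAK section
enter).  Theorems only; no definition, no named fact, no instance, no notation, no `sorry`.

THE MATHEMATICS ([KnappVogan1995, §I.4 (1.64)–(1.65)]; [Hall2015, Cor. 3.44]; [Knapp2002, I.§10 Prop. 1.89]).  Let `G` be a linear real group over a
finite-dimensional coefficient algebra with FULL Lie algebra (`hreg`: every `X` with `exp(tX) ∈ G` for all `t` lies in `𝔤`, e.g. ★ `uFormGroup_regular`),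
`(ρK, ρ𝔤)` a `(𝔤, K)`-module (★ `IsGKModule`), and `k : ℝ → K` a curve whose MATRIX is differentiable at `s₀`.
* (the log chart `exists_log_curve`, `inv_mul_deriv_mem_compactLie` is ★ `GKModulesCurveLogChart`)
* §4 **`hasDerivAt_coeff_curve`**: if the matrix of `k` has derivative `k(s₀) · Y` at `s₀` (`Y ∈ 𝔨`), then for every `v ∈ V` and functional `ℓ`,
  `HasDerivAt (s ↦ ℓ (ρK (k s) v)) (ℓ (ρK (k s₀) (ρ𝔤 Y v))) s₀`: on the finite-dimensional `K`-span `F ∋ v`, `ρK (expK Z)|_F = exp (mat (ρ𝔤 Z))`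
  (★ `coords_expK`), the matrix map `Z ↦ mat (ρ𝔤 (π Z))` is continuous linear (`π` a linear projection onto `𝔤`, as in ★ `ArchimedeanCalculusRegular`), and
  `exp` has derivative `id` at `0` (Mathlib `hasFDerivAt_exp_zero`); chain rule along `L`.  **`hasDerivAt_map_curve`**: the same through any linear
  `ι : V →ₗ[ℂ] E` into a normed space (coordinates in the `K`-span).  `hasDerivAt_coeff_curve'`∕`hasDerivAt_map_curve'`: the forms with an arbitrary matrix
  derivative `k′` (log-derivative `⟨k(s₀)⁻¹ k′, inv_mul_deriv_mem_compactLie⟩`).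

HONEST LABEL: helper brick; closes no registered stub.  HC_CM is proved only modulo the 2 remaining named inputs (hLiu418, h413) until rung 0 closes.

## Mathlib ∕ tree search
Mathlib: `ContDiffAt.differentiableAt`, `HasFDerivAt.comp_hasDerivAt`, `HasFDerivAt.unique`, `Units.isInducing_embedProduct`, `Units.inv_eq_of_mul_eq_one_left`,
`NormedSpace.star_exp`, `Matrix.exp_neg`, `Matrix.inv_eq_left_inv`, `Submodule.exists_isCompl`∕`projectionOnto_apply_of_mem_left`, `Submodule.closed_of_finiteDimensional`,
`HasDerivAt.tendsto_slope`, `hasFDerivAt_exp_zero`.  Tree: ★ `exists_contDiffAt_log_inverse`, ★ `RealMatrixGroup.eventually_nhds_one_log_mem`, ★ `mem_unitarySubgroupGL_iff`,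
★ `RealMatrixGroup.mem_compactLie_iff`∕`coe_expK`, ★ `GKModulesKSpanMatrixExp`.  Dedup: `rg "hasDerivAt_coeff_curve|exists_log_curve|inv_mul_deriv_mem"` over `Literature/` — no hits.

## References
* A. W. Knapp, D. A. Vogan, *Cohomological Induction and Unitary Representations* (1995), §I.4 (1.64)–(1.65) [KnappVogan1995].
* B. C. Hall, *Lie Groups, Lie Algebras, and Representations*, 2nd ed., GTM 222 (2015), Thm. 3.42, Cor. 3.44 [Hall2015].
* A. W. Knapp, *Lie Groups Beyond an Introduction*, 2nd ed. (2002), I.§10, Prop. 1.89 [Knapp2002].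
-/

set_option autoImplicit false

noncomputable section

-- Mathlib idiom (as in ★ `GKModules`): the commutator bracket on `Module.End ℂ V` ∕ matrices, to MENTION `ρ𝔤 : 𝔤 →ₗ⁅ℝ⁆ End V`.
attribute [local instance 100] LieRing.ofAssociativeRing

open Filter Topology Finset Matrix
open scoped Nat Matrix.Norms.Operator ContDiff

namespace Literature.NumberTheory.Automorphic

namespace IsGKModule

variable {A : Type*} [NormedCommRing A] [NormedAlgebra ℝ A] [NormedAlgebra ℚ A] [CompleteSpace A]
  [StarRing A] [StarModule ℝ A] [ContinuousStar A] {N : Type*} [Fintype N] [DecidableEq N]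
  {G : RealMatrixGroup A N}
  {V : Type*} [AddCommGroup V] [Module ℂ V]
  {ρK : Representation ℂ G.maximalCompact V} {ρ𝔤 : G.lie →ₗ⁅ℝ⁆ Module.End ℂ V}

/-! ## §4 The derivative of `K`-orbit maps along differentiable curves -/

section Curve

variable [FiniteDimensional ℝ A]

/-- **K-DERIVATIVE ALONG CURVES (matrix coefficients).**  For a regular linear real group `G` over a finite-dimensional coefficient algebra,
a `(𝔤, K)`-module `(ρK, ρ𝔤)`, and a curve `k : ℝ → K` whose matrix has derivative `k(s₀) · Y` at `s₀` with `Y ∈ 𝔨`: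
`d/ds|_{s₀} ℓ (ρK (k s) v) = ℓ (ρK (k s₀) (ρ𝔤 Y v))` for every `v ∈ V` and functional `ℓ`.  [Knapp–Vogan (1.64)–(1.65): the `K`-action
is differentiable with differential `ρ𝔤|_𝔨`.] [cite: KnappVogan1995, §I.4 (1.64)–(1.65)] [cite: Hall2015, Cor. 3.44] -/
theorem hasDerivAt_coeff_curve (hreg : ∀ X : Matrix N N A, (∀ t : ℝ, expGL (t • X) ∈ G.carrier) → X ∈ G.lie)
    (h : IsGKModule G ρK ρ𝔤) {k : ℝ → G.maximalCompact} {s₀ : ℝ} {Y : G.compactLie}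
    (hk : HasDerivAt (fun s => (((k s : G.maximalCompact) : GL N A) : Matrix N N A))
      ((((k s₀ : G.maximalCompact) : GL N A) : Matrix N N A) * (Y : Matrix N N A)) s₀)
    (v : V) (ℓ : Module.Dual ℂ V) :
    HasDerivAt (fun s => ℓ (ρK (k s) v)) (ℓ (ρK (k s₀) (ρ𝔤 (LieSubalgebra.inclusion G.compactLie_le_lie Y) v))) s₀ := by
  -- the finite-dimensional `K`-span `F` of `v`, a basis, coordinates
  set F : Submodule ℂ V := Submodule.span ℂ (Set.range fun k : G.maximalCompact => ρK k v) with hFdef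
  haveI : FiniteDimensional ℂ F := h.kFinite v
  have hF : ∀ (k : G.maximalCompact), ∀ w ∈ F, ρK k w ∈ F := by
    intro k' w hw
    have hmap : F.map (ρK k' : V →ₗ[ℂ] V) ≤ F := by
      rw [hFdef, Submodule.map_span]
      refine Submodule.span_mono ?_
      rintro _ ⟨_, ⟨k'', rfl⟩, rfl⟩
      exact ⟨k' * k'', by simp [map_mul]⟩
    exact hmap ⟨w, hw, rfl⟩
  have hv : v ∈ F := by
    have h1 : ρK 1 v ∈ F := Submodule.subset_span ⟨1, rfl⟩
    rwa [map_one, Module.End.one_apply] at h1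
  set d := Module.finrank ℂ F
  let b : Module.Basis (Fin d) ℂ F := Module.finBasis ℂ F
  -- a continuous linear projection onto `𝔤` and the matrix-of-`ρ𝔤` map on all matrices
  obtain ⟨q, hpq⟩ := Submodule.exists_isCompl (G.lie.toSubmodule : Submodule ℝ (Matrix N N A))
  let πl : Matrix N N A →ₗ[ℝ] G.lie.toSubmodule := G.lie.toSubmodule.projectionOnto q hpq
  have hπ : ∀ X : Matrix N N A, ∀ hX : X ∈ G.lie, πl X = ⟨X, hX⟩ := fun X hX => Submodule.projectionOnto_apply_of_mem_left hpq hX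
  let Ml : Matrix N N A →ₗ[ℝ] Matrix (Fin d) (Fin d) ℂ :=
    { toFun := fun X => mat b (ρ𝔤 ⟨(πl X : Matrix N N A), (πl X).2⟩ : V →ₗ[ℂ] V)
      map_add' := fun X X' => by
        have hπ' : (⟨(πl (X + X') : Matrix N N A), (πl (X + X')).2⟩ : G.lie) =
            ⟨(πl X : Matrix N N A), (πl X).2⟩ + ⟨(πl X' : Matrix N N A), (πl X').2⟩ := by ext1; simp [map_add]
        have hT : (ρ𝔤 ⟨(πl (X + X') : Matrix N N A), (πl (X + X')).2⟩ : V →ₗ[ℂ] V) =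
            (ρ𝔤 ⟨(πl X : Matrix N N A), (πl X).2⟩ : V →ₗ[ℂ] V) + (ρ𝔤 ⟨(πl X' : Matrix N N A), (πl X').2⟩ : V →ₗ[ℂ] V) := by
          rw [hπ', map_add]
        ext i j
        simp only [mat, Matrix.of_apply, Matrix.add_apply]
        rw [hT, LinearMap.add_apply, map_add]
      map_smul' := fun c X => by
        have hπ' : (⟨(πl (c • X) : Matrix N N A), (πl (c • X)).2⟩ : G.lie) = c • ⟨(πl X : Matrix N N A), (πl X).2⟩ := by
          ext1; simp [map_smul]
        have hT : (ρ𝔤 ⟨(πl (c • X) : Matrix N N A), (πl (c • X)).2⟩ : V →ₗ[ℂ] V) =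
            c • (ρ𝔤 ⟨(πl X : Matrix N N A), (πl X).2⟩ : V →ₗ[ℂ] V) := by
          rw [hπ', map_smul]
        ext i j
        simp only [mat, Matrix.of_apply, Matrix.smul_apply, RingHom.id_apply]
        rw [hT, LinearMap.smul_apply, LinearMap.map_smul_of_tower] }
  let ML : Matrix N N A →L[ℝ] Matrix (Fin d) (Fin d) ℂ := ⟨Ml, Ml.continuous_of_finiteDimensional⟩
  have hML : ∀ Z : G.compactLie, ML (Z : Matrix N N A) = mat b (ρ𝔤 (LieSubalgebra.inclusion G.compactLie_le_lie Z) : V →ₗ[ℂ] V) := by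
    intro Z
    show mat b (ρ𝔤 ⟨(πl (Z : Matrix N N A) : Matrix N N A), _⟩ : V →ₗ[ℂ] V) = _
    congr 2
    ext1
    simp only [hπ _ (G.compactLie_le_lie Z.2)]
    rfl
  -- the logarithm of the curve
  obtain ⟨L, hL0, hL', hev⟩ := exists_log_curve (G := G) hreg hk
  -- the smooth model `Ψ`
  let c : Fin d → ℂ := coords b v
  let Ψ : ℝ → ℂ := fun s => ∑ i, (NormedSpace.exp (ML (L s)) *ᵥ c) i * ℓ (ρK (k s₀) (b i : V))
  -- `Ψ` agrees with the orbit coefficient near `s₀`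
  have heq : (fun s => ℓ (ρK (k s) v)) =ᶠ[𝓝 s₀] Ψ := by
    filter_upwards [hev] with s hs
    obtain ⟨hLs, hks⟩ := hs
    have hexp := coords_expK b h hF ⟨L s, hLs⟩ hv
    rw [← hML ⟨L s, hLs⟩] at hexp
    -- expand `ρK (expK (L s)) v` in the basis
    have hmemK : ρK (G.expK ⟨L s, hLs⟩) v ∈ F := hF _ _ hv
    have hexpand := sum_coordFn_smul b hmemK
    show ℓ (ρK (k s) v) = ∑ i, (NormedSpace.exp (ML (L s)) *ᵥ c) i * ℓ (ρK (k s₀) (b i : V))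
    rw [hks, map_mul, Module.End.mul_apply, ← hexpand, map_sum, map_sum]
    refine Finset.sum_congr rfl fun i _ => ?_
    rw [map_smul, map_smul, smul_eq_mul]
    congr 1
    show coords b (ρK (G.expK ⟨L s, hLs⟩) v) i = _
    rw [hexp]
  -- `Ψ` is differentiable at `s₀` with the right derivative
  have hexpd : HasFDerivAt (NormedSpace.exp : Matrix (Fin d) (Fin d) ℂ → Matrix (Fin d) (Fin d) ℂ)
      (ContinuousLinearMap.id ℝ _) (ML (L s₀)) := by
    rw [hL0, map_zero]
    exact (hasFDerivAt_exp_zero (𝕂 := ℝ) (𝔸 := Matrix (Fin d) (Fin d) ℂ)).congr_fderiv ContinuousLinearMap.one_def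
  have h1 : HasDerivAt (fun s => ML (L s)) (ML (Y : Matrix N N A)) s₀ := ML.hasFDerivAt.comp_hasDerivAt s₀ hL'
  have hE := hexpd.comp_hasDerivAt s₀ h1
  have hΨ : HasDerivAt Ψ (∑ i, (ML (Y : Matrix N N A) *ᵥ c) i * ℓ (ρK (k s₀) (b i : V))) s₀ := by
    refine HasDerivAt.fun_sum fun i _ => ?_
    refine HasDerivAt.mul_const ?_ _
    -- the coordinate `P ↦ (P *ᵥ c) i` is a continuous linear map (over `ℝ`)
    let Li : Matrix (Fin d) (Fin d) ℂ →ₗ[ℝ] ℂ :=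
      { toFun := fun P => (P *ᵥ c) i
        map_add' := fun P Q => by rw [Matrix.add_mulVec]; rfl
        map_smul' := fun r P => by rw [Matrix.smul_mulVec, RingHom.id_apply]; rfl }
    let LiL : Matrix (Fin d) (Fin d) ℂ →L[ℝ] ℂ := ⟨Li, Li.continuous_of_finiteDimensional⟩
    have h3 := LiL.hasFDerivAt.comp_hasDerivAt s₀ hE
    exact h3.congr_deriv rfl
  -- identify the derivative
  have hder : ∑ i, (ML (Y : Matrix N N A) *ᵥ c) i * ℓ (ρK (k s₀) (b i : V)) =
      ℓ (ρK (k s₀) (ρ𝔤 (LieSubalgebra.inclusion G.compactLie_le_lie Y) v)) := by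
    rw [hML Y, mat_mulVec_coords b _ hv]
    have hmem : ρ𝔤 (LieSubalgebra.inclusion G.compactLie_le_lie Y) v ∈ F :=
      IsGKModule.apply_mem_of_K_stable_of_hasWeakDeriv h.hasWeakDeriv Y hF hv
    conv_rhs => rw [← sum_coordFn_smul b hmem, map_sum, map_sum]
    refine Finset.sum_congr rfl fun i _ => ?_
    rw [map_smul, map_smul, smul_eq_mul, coords]
  rw [← hder]
  exact hΨ.congr_of_eventuallyEq heq

/-- **K-DERIVATIVE ALONG CURVES (vector-valued form).**  Same hypotheses; for any complex normed space `E` which is also a compatible real normed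
space and any linear `ι : V →ₗ[ℂ] E`: `d/ds|_{s₀} ι (ρK (k s) v) = ι (ρK (k s₀) (ρ𝔤 Y v))`. [cite: KnappVogan1995, §I.4 (1.64)–(1.65)] -/
theorem hasDerivAt_map_curve (hreg : ∀ X : Matrix N N A, (∀ t : ℝ, expGL (t • X) ∈ G.carrier) → X ∈ G.lie)
    (h : IsGKModule G ρK ρ𝔤) {k : ℝ → G.maximalCompact} {s₀ : ℝ} {Y : G.compactLie}
    (hk : HasDerivAt (fun s => (((k s : G.maximalCompact) : GL N A) : Matrix N N A))
      ((((k s₀ : G.maximalCompact) : GL N A) : Matrix N N A) * (Y : Matrix N N A)) s₀)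
    {E : Type*} [NormedAddCommGroup E] [NormedSpace ℂ E] [NormedSpace ℝ E] [IsScalarTower ℝ ℂ E] (ι : V →ₗ[ℂ] E) (v : V) :
    HasDerivAt (fun s => ι (ρK (k s) v)) (ι (ρK (k s₀) (ρ𝔤 (LieSubalgebra.inclusion G.compactLie_le_lie Y) v))) s₀ := by
  set F : Submodule ℂ V := Submodule.span ℂ (Set.range fun k : G.maximalCompact => ρK k v) with hFdef
  haveI : FiniteDimensional ℂ F := h.kFinite v
  have hF : ∀ (k : G.maximalCompact), ∀ w ∈ F, ρK k w ∈ F := by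
    intro k' w hw
    have hmap : F.map (ρK k' : V →ₗ[ℂ] V) ≤ F := by
      rw [hFdef, Submodule.map_span]
      refine Submodule.span_mono ?_
      rintro _ ⟨_, ⟨k'', rfl⟩, rfl⟩
      exact ⟨k' * k'', by simp [map_mul]⟩
    exact hmap ⟨w, hw, rfl⟩
  have hv : v ∈ F := by
    have h1 : ρK 1 v ∈ F := Submodule.subset_span ⟨1, rfl⟩
    rwa [map_one, Module.End.one_apply] at h1
  let b := Module.finBasis ℂ F
  have hexp : ∀ w ∈ F, ι w = ∑ i, coordFn b i w • ι (b i : V) := fun w hw => by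
    conv_lhs => rw [← sum_coordFn_smul b hw]
    simp only [map_sum, map_smul]
  have hfun : (fun s => ι (ρK (k s) v)) = fun s => ∑ i, coordFn b i (ρK (k s) v) • ι (b i : V) :=
    funext fun s => hexp _ (hF _ _ hv)
  have hmem : ρK (k s₀) (ρ𝔤 (LieSubalgebra.inclusion G.compactLie_le_lie Y) v) ∈ F :=
    hF _ _ (IsGKModule.apply_mem_of_K_stable_of_hasWeakDeriv h.hasWeakDeriv Y hF hv)
  rw [hfun, hexp _ hmem]
  refine HasDerivAt.fun_sum fun i _ => ?_
  exact (hasDerivAt_coeff_curve hreg h hk v (coordFn b i)).smul_const (ι (b i : V))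

/-- **Arbitrary-derivative form** of `hasDerivAt_coeff_curve`: for a curve `k : ℝ → K` whose matrix has derivative `k′` at `s₀`, with the
log-derivative `Y := k(s₀)⁻¹ k′ ∈ 𝔨` (`inv_mul_deriv_mem_compactLie`). [cite: KnappVogan1995, §I.4 (1.64)–(1.65)] -/
theorem hasDerivAt_coeff_curve' (hreg : ∀ X : Matrix N N A, (∀ t : ℝ, expGL (t • X) ∈ G.carrier) → X ∈ G.lie)
    (h : IsGKModule G ρK ρ𝔤) {k : ℝ → G.maximalCompact} {s₀ : ℝ} {k' : Matrix N N A}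
    (hk : HasDerivAt (fun s => (((k s : G.maximalCompact) : GL N A) : Matrix N N A)) k' s₀) (v : V) (ℓ : Module.Dual ℂ V) :
    HasDerivAt (fun s => ℓ (ρK (k s) v))
      (ℓ (ρK (k s₀) (ρ𝔤 (LieSubalgebra.inclusion G.compactLie_le_lie
        ⟨((((k s₀)⁻¹ : G.maximalCompact) : GL N A) : Matrix N N A) * k', inv_mul_deriv_mem_compactLie hreg hk⟩) v))) s₀ := by
  refine hasDerivAt_coeff_curve hreg h (hk.congr_deriv ?_) v ℓ
  show k' = (((k s₀ : G.maximalCompact) : GL N A) : Matrix N N A) * (((((k s₀)⁻¹ : G.maximalCompact) : GL N A) : Matrix N N A) * k')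
  rw [← mul_assoc, Subgroup.coe_inv, Units.mul_inv, one_mul]

/-- **Arbitrary-derivative, vector-valued form** of `hasDerivAt_map_curve`. [cite: KnappVogan1995, §I.4 (1.64)–(1.65)] -/
theorem hasDerivAt_map_curve' (hreg : ∀ X : Matrix N N A, (∀ t : ℝ, expGL (t • X) ∈ G.carrier) → X ∈ G.lie)
    (h : IsGKModule G ρK ρ𝔤) {k : ℝ → G.maximalCompact} {s₀ : ℝ} {k' : Matrix N N A}
    (hk : HasDerivAt (fun s => (((k s : G.maximalCompact) : GL N A) : Matrix N N A)) k' s₀)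
    {E : Type*} [NormedAddCommGroup E] [NormedSpace ℂ E] [NormedSpace ℝ E] [IsScalarTower ℝ ℂ E] (ι : V →ₗ[ℂ] E) (v : V) :
    HasDerivAt (fun s => ι (ρK (k s) v))
      (ι (ρK (k s₀) (ρ𝔤 (LieSubalgebra.inclusion G.compactLie_le_lie
        ⟨((((k s₀)⁻¹ : G.maximalCompact) : GL N A) : Matrix N N A) * k', inv_mul_deriv_mem_compactLie hreg hk⟩) v))) s₀ := by
  refine hasDerivAt_map_curve hreg h (hk.congr_deriv ?_) ι v
  show k' = (((k s₀ : G.maximalCompact) : GL N A) : Matrix N N A) * (((((k s₀)⁻¹ : G.maximalCompact) : GL N A) : Matrix N N A) * k')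
  rw [← mul_assoc, Subgroup.coe_inv, Units.mul_inv, one_mul]

end Curve

end IsGKModule

end Literature.NumberTheory.Automorphic

end
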